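import Mathlib
import Summits.Ventures.HodgeRepro2.A1GaloisTensorSplitting
import Summits.Ventures.HodgeRepro2.T5EmbeddingPrimeEquiv
import Summits.Ventures.HodgeRepro2.T5EmbeddingTorsor

/-!
# T5EmbeddingFactorisation — every embedding of `E` into an extension of `ℚ_p` factors through `ℚ_p`
  when `p` splits completely in `E`

Tier-5 support of seat p7 (route/T5-CHECK-G-p7.md §18.3 (i); route/T5-LEAN-p7.md §52).

The print ([P1], Hsieh, the source's `\Qbarp` = ℂ_p, CHECK-G §12.3 (c)) fixes an embedding
`ι_p : ℚ̄ → ℂ_p` and reads the p-adic place «induced by σ ∈ Σ via ι_p» off the composite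
`ι_p ∘ σ : E → ℂ_p`.  The kernel files of rows 57–65 (LEAN-ANNEX-p7) work with embeddings
`E →+* ℚ_[p]` instead, because ℂ_p is not in Mathlib.  This file closes the modelling gap:
for ANY field `M` containing `ℚ_[p]` (ℂ_p in print), and any field `E` with
`#Hom(E, ℚ_p) = [E : ℚ]` (p splits completely in `E`: rows 59 / 60), every ring hom `E →+* M`
factors UNIQUELY through `ℚ_[p] ⊆ M` — so `Hom(E, M) = Hom(E, ℚ_p)` and nothing is lost by
reading `ι_p ∘ σ` as an embedding into `ℚ_p`.

The general statement (section `Factor`): `K ⊆ L ⊆ M` fields, `F/K` finite with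
`#(F →ₐ[K] L) = [F : K]`; then `σ ↦ (algebraMap L M) ∘ σ` is a bijection
`(F →ₐ[K] L) ≃ (F →ₐ[K] M)`.  Proof: the `L`-algebra hom `L ⊗[K] F → M` attached to
`ι : F →ₐ[K] M` is, through row 42's splitting `L ⊗[K] F ≃ₐ[L] (Emb → L)`, an `L`-algebra hom
from a finite product of copies of `L` into the field `M`; the images of the idempotents
`Pi.single σ 1` are idempotents of a domain, hence `0` or `1`, orthogonal and summing to `1`,
so exactly one of them is `1` and the hom is evaluation at that coordinate (section `Pi`).

Nothing about CM types, Hecke characters or L-functions is asserted.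
Axioms: standard.  README §8(d): uses an L-value-free non-vanishing device: NO.
-/

namespace Summit.Ventures.HodgeRepro2.T5EmbeddingFactorisation

open A1GaloisTensorSplitting TensorProduct Module

/-! ## An algebra hom from a finite product of copies of `R` into a domain is a coordinate evaluation -/
section Pi

variable {R : Type*} [CommSemiring R] {ι : Type*} [DecidableEq ι]
variable {M : Type*} [CommRing M] [Algebra R M]

/-- The idempotents `e_i = Pi.single i 1` of `ι → R` are orthogonal. -/
theorem single_one_mul_single_one_of_ne {i j : ι} (h : i ≠ j) :
    (Pi.single i (1 : R) : ι → R) * Pi.single j 1 = 0 := by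
  ext k
  simp only [Pi.mul_apply, Pi.single_apply, Pi.zero_apply]
  split_ifs with hki hkj
  · exact absurd (hki.symm.trans hkj) h
  · exact mul_zero _
  · exact zero_mul _
  · exact zero_mul _

/-- The image of `e_i` under an `R`-algebra hom is an idempotent. -/
theorem isIdempotentElem_map_single (Ψ : (ι → R) →ₐ[R] M) (i : ι) :
    IsIdempotentElem (Ψ (Pi.single i 1)) := by
  unfold IsIdempotentElem
  rw [← map_mul, ← Pi.single_mul, mul_one]

/-- `∑ i, e_i = 1` in `ι → R`. -/
theorem sum_single_one [Fintype ι] : (∑ i : ι, (Pi.single i (1 : R) : ι → R)) = 1 :=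
  Finset.univ_sum_single (fun _ : ι => (1 : R))

/-- The images of the `e_i` sum to `1`. -/
theorem sum_map_single [Fintype ι] (Ψ : (ι → R) →ₐ[R] M) :
    ∑ i, Ψ (Pi.single i (1 : R)) = 1 := by
  rw [← map_sum, sum_single_one, map_one]

/-- Some `e_i` maps to `1`: the images are `0` or `1` (idempotents of a domain) and sum to `1`. -/
theorem exists_map_single_eq_one [Fintype ι] [IsDomain M] (Ψ : (ι → R) →ₐ[R] M) :
    ∃ i, Ψ (Pi.single i 1) = 1 := by
  by_contra h
  have h0 : ∀ i, Ψ (Pi.single i (1 : R)) = 0 := fun i =>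
    ((IsIdempotentElem.iff_eq_zero_or_one.mp (isIdempotentElem_map_single Ψ i)).resolve_right
      (fun h1 => h ⟨i, h1⟩))
  have hs := sum_map_single Ψ
  simp only [h0, Finset.sum_const_zero] at hs
  exact zero_ne_one hs

/-- If `e_i ↦ 1` then every other `e_j ↦ 0` (orthogonality). -/
theorem map_single_eq_zero_of_ne (Ψ : (ι → R) →ₐ[R] M) {i j : ι}
    (hi : Ψ (Pi.single i 1) = 1) (hij : j ≠ i) : Ψ (Pi.single j 1) = 0 := by
  have h : Ψ (Pi.single j 1) = Ψ (Pi.single j 1) * Ψ (Pi.single i 1) := by rw [hi, mul_one]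
  rw [h, ← map_mul, single_one_mul_single_one_of_ne hij, map_zero]

/-- If `e_i ↦ 1` then `Ψ` is evaluation at `i` (followed by `algebraMap`). -/
theorem map_eq_algebraMap_apply [Fintype ι] (Ψ : (ι → R) →ₐ[R] M) {i : ι}
    (hi : Ψ (Pi.single i 1) = 1) (f : ι → R) : Ψ f = algebraMap R M (f i) := by
  conv_lhs => rw [← Finset.univ_sum_single f]
  rw [map_sum]
  have h : ∀ j, Ψ (Pi.single j (f j)) = if j = i then algebraMap R M (f i) else 0 := by
    intro j
    have hs : (Pi.single j (f j) : ι → R) = f j • (Pi.single j (1 : R) : ι → R) := by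
      rw [← Pi.single_smul, smul_eq_mul, mul_one]
    rw [hs, map_smul, Algebra.smul_def]
    split_ifs with hji
    · subst hji; rw [hi, mul_one]
    · rw [map_single_eq_zero_of_ne Ψ hi hji, mul_zero]
  simp only [h, Finset.sum_ite_eq', Finset.mem_univ, if_true]

/-- **Every `R`-algebra hom from `ι → R` (finite `ι`) into a domain is a coordinate evaluation.** -/
theorem exists_forall_eq_algebraMap [Fintype ι] [IsDomain M] (Ψ : (ι → R) →ₐ[R] M) :
    ∃ i, ∀ f, Ψ f = algebraMap R M (f i) :=
  let ⟨i, hi⟩ := exists_map_single_eq_one Ψ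
  ⟨i, map_eq_algebraMap_apply Ψ hi⟩

end Pi

/-! ## The factorisation `(F →ₐ[K] L) ≃ (F →ₐ[K] M)` -/
section Factor

variable (K L F M : Type*) [Field K] [Field L] [Algebra K L] [Field F] [Algebra K F]
  [Field M] [Algebra K M] [Algebra L M] [IsScalarTower K L M]

/-- The `L`-algebra hom `L ⊗[K] F → M`, `c ⊗ x ↦ c · ι x`, attached to `ι : F →ₐ[K] M`. -/
noncomputable def liftTensor (ι : F →ₐ[K] M) : L ⊗[K] F →ₐ[L] M :=
  Algebra.TensorProduct.lift (Algebra.ofId L M) ι (fun _ _ => Commute.all _ _)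

/-- `c ⊗ x ↦ c · ι x`. -/
theorem liftTensor_tmul (ι : F →ₐ[K] M) (c : L) (x : F) :
    liftTensor K L F M ι (c ⊗ₜ x) = algebraMap L M c * ι x := by
  simp only [liftTensor, Algebra.TensorProduct.lift_tmul, Algebra.ofId_apply]

/-- `σ ↦ (algebraMap L M) ∘ σ`. -/
noncomputable def extend (σ : Emb K L F) : F →ₐ[K] M :=
  (IsScalarTower.toAlgHom K L M).comp σ

/-- `extend σ x = algebraMap L M (σ x)`. -/
@[simp] theorem extend_apply (σ : Emb K L F) (x : F) :
    extend K L F M σ x = algebraMap L M (σ x) := rfl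

/-- `σ ↦ (algebraMap L M) ∘ σ` is injective (`algebraMap L M` is). -/
theorem extend_injective : Function.Injective (extend K L F M) := by
  intro σ τ h
  ext x
  apply (algebraMap L M).injective
  have := congrArg (fun φ : F →ₐ[K] M => φ x) h
  simpa only [extend_apply] using this

variable [FiniteDimensional K F] [Fintype (Emb K L F)]

/-- The same hom read on row 42's splitting `L ⊗[K] F ≃ₐ[L] (Emb K L F → L)`. -/
noncomputable def liftPi (hcard : Fintype.card (Emb K L F) = finrank K F) (ι : F →ₐ[K] M) :
    (Emb K L F → L) →ₐ[L] M :=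
  (liftTensor K L F M ι).comp (tensorEquiv K L F hcard).symm.toAlgHom

/-- On the vector `(σ x)_σ` — the image of `1 ⊗ x` — the hom returns `ι x`. -/
theorem liftPi_apply_fun (hcard : Fintype.card (Emb K L F) = finrank K F) (ι : F →ₐ[K] M)
    (x : F) : liftPi K L F M hcard ι (fun σ => σ x) = ι x := by
  have h : (tensorEquiv K L F hcard).symm (fun σ => σ x) = (1 : L) ⊗ₜ[K] x := by
    rw [AlgEquiv.symm_apply_eq, tensorEquiv_tmul]
    ext σ
    simp only [one_mul]
  show liftTensor K L F M ι ((tensorEquiv K L F hcard).symm (fun σ => σ x)) = ι x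
  rw [h, liftTensor_tmul, map_one, one_mul]

/-- **Every `K`-embedding `F → M` factors through some `K`-embedding `F → L`** when
`#(F →ₐ[K] L) = [F : K]`. -/
theorem exists_factor (hcard : Fintype.card (Emb K L F) = finrank K F) (ι : F →ₐ[K] M) :
    ∃ σ : Emb K L F, ∀ x, ι x = algebraMap L M (σ x) := by
  classical
  obtain ⟨σ, hσ⟩ := exists_forall_eq_algebraMap (liftPi K L F M hcard ι)
  exact ⟨σ, fun x => by rw [← liftPi_apply_fun K L F M hcard ι x, hσ]⟩

/-- `σ ↦ (algebraMap L M) ∘ σ` is surjective: `exists_factor`. -/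
theorem extend_surjective (hcard : Fintype.card (Emb K L F) = finrank K F) :
    Function.Surjective (extend K L F M) := fun ι => by
  obtain ⟨σ, hσ⟩ := exists_factor K L F M hcard ι
  exact ⟨σ, by ext x; rw [extend_apply, hσ x]⟩

/-- `σ ↦ (algebraMap L M) ∘ σ` is a bijection `(F →ₐ[K] L) → (F →ₐ[K] M)`. -/
theorem extend_bijective (hcard : Fintype.card (Emb K L F) = finrank K F) :
    Function.Bijective (extend K L F M) :=
  ⟨extend_injective K L F M, extend_surjective K L F M hcard⟩

/-- **The bijection `(F →ₐ[K] L) ≃ (F →ₐ[K] M)`, `σ ↦ (algebraMap L M) ∘ σ`.** -/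
noncomputable def algHomEquiv (hcard : Fintype.card (Emb K L F) = finrank K F) :
    Emb K L F ≃ (F →ₐ[K] M) :=
  Equiv.ofBijective _ (extend_bijective K L F M hcard)

/-- `algHomEquiv σ = (algebraMap L M) ∘ σ`. -/
@[simp] theorem algHomEquiv_apply (hcard : Fintype.card (Emb K L F) = finrank K F)
    (σ : Emb K L F) : algHomEquiv K L F M hcard σ = extend K L F M σ := rfl

/-- The factorisation is unique. -/
theorem existsUnique_factor (hcard : Fintype.card (Emb K L F) = finrank K F) (ι : F →ₐ[K] M) :
    ∃! σ : Emb K L F, ∀ x, ι x = algebraMap L M (σ x) := by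
  obtain ⟨σ, hσ⟩ := exists_factor K L F M hcard ι
  refine ⟨σ, hσ, fun τ hτ => extend_injective K L F M ?_⟩
  ext x
  rw [extend_apply, extend_apply, ← hσ x, ← hτ x]

/-- `#(F →ₐ[K] M) = [F : K]` as well. -/
theorem card_algHom_eq (hcard : Fintype.card (Emb K L F) = finrank K F) :
    Nat.card (F →ₐ[K] M) = finrank K F := by
  rw [← Nat.card_congr (algHomEquiv K L F M hcard), Nat.card_eq_fintype_card, hcard]

end Factor

/-! ## The datum: `E` a number field in which `p` splits completely, `M ⊇ ℚ_p` any field (ℂ_p in print) -/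
section Padic

/-- `M` has characteristic zero (it contains `ℚ_p`). -/
theorem charZero (p : ℕ) [Fact (Nat.Prime p)] (M : Type*) [Field M] [Algebra ℚ_[p] M] :
    CharZero M :=
  charZero_of_injective_algebraMap (algebraMap ℚ_[p] M).injective

/-- `ℚ ⊆ ℚ_p ⊆ M` is a scalar tower (the rational structure of `M` is the one through `ℚ_p`). -/
theorem isScalarTower_rat (p : ℕ) [Fact (Nat.Prime p)] (M : Type*) [Field M] [Algebra ℚ_[p] M]
    [CharZero M] : IsScalarTower ℚ ℚ_[p] M :=
  IsScalarTower.of_algebraMap_eq fun r => (RingHom.map_rat_algebraMap (algebraMap ℚ_[p] M) r).symm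

variable (E : Type*) [Field E] [NumberField E] (p : ℕ) [Fact (Nat.Prime p)]
variable (M : Type*) [Field M] [Algebra ℚ_[p] M]

/-- `#(E →ₐ[ℚ] ℚ_p) = [E : ℚ]` from `#(E →+* ℚ_p) = [E : ℚ]`. -/
theorem card_emb_eq (hcard : Nat.card (E →+* ℚ_[p]) = finrank ℚ E) :
    Fintype.card (Emb ℚ ℚ_[p] E) = finrank ℚ E := by
  rw [← Nat.card_eq_fintype_card, ← hcard]
  exact (Nat.card_congr (RingHom.equivRatAlgHom (R := E) (S := ℚ_[p]))).symm

/-- **Every ring hom `E → M` factors uniquely through `ℚ_p ⊆ M`** when `#(E →+* ℚ_p) = [E : ℚ]`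
(p splits completely in `E`, rows 59 / 60).  In print: `ι_p ∘ σ : E → ℂ_p` lands in `ℚ_p`. -/
theorem existsUnique_ringHom_factor (hcard : Nat.card (E →+* ℚ_[p]) = finrank ℚ E)
    (ι : E →+* M) : ∃! φ : E →+* ℚ_[p], ι = (algebraMap ℚ_[p] M).comp φ := by
  haveI : CharZero M := charZero p M
  haveI : IsScalarTower ℚ ℚ_[p] M := isScalarTower_rat p M
  obtain ⟨σ, hσ, huniq⟩ :=
    existsUnique_factor ℚ ℚ_[p] E M (card_emb_eq E p hcard) (RingHom.toRatAlgHom ι)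
  refine ⟨σ.toRingHom, ?_, ?_⟩
  · ext x
    exact hσ x
  · intro φ hφ
    have hφ' : ∀ x, (RingHom.toRatAlgHom ι) x = algebraMap ℚ_[p] M ((RingHom.toRatAlgHom φ) x) :=
      fun x => by
        simp only [RingHom.toRatAlgHom_apply, hφ, RingHom.comp_apply]
    have := huniq (RingHom.toRatAlgHom φ) hφ'
    rw [← this]
    rfl

/-- The bijection `(E →+* ℚ_p) ≃ (E →+* M)`, `φ ↦ (algebraMap ℚ_p M) ∘ φ`. -/
noncomputable def ringHomEquiv (hcard : Nat.card (E →+* ℚ_[p]) = finrank ℚ E) :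
    (E →+* ℚ_[p]) ≃ (E →+* M) :=
  Equiv.ofBijective (fun φ => (algebraMap ℚ_[p] M).comp φ) (by
    constructor
    · intro φ ψ h
      ext x
      apply (algebraMap ℚ_[p] M).injective
      have := congrArg (fun χ : E →+* M => χ x) h
      simpa only [RingHom.comp_apply] using this
    · intro ι
      obtain ⟨φ, hφ, -⟩ := existsUnique_ringHom_factor E p M hcard ι
      exact ⟨φ, hφ.symm⟩)

/-- `ringHomEquiv φ = (algebraMap ℚ_p M) ∘ φ`. -/
@[simp] theorem ringHomEquiv_apply (hcard : Nat.card (E →+* ℚ_[p]) = finrank ℚ E)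
    (φ : E →+* ℚ_[p]) : ringHomEquiv E p M hcard φ = (algebraMap ℚ_[p] M).comp φ := rfl

/-- `#(E →+* M) = [E : ℚ]`: the embeddings of `E` into any extension of `ℚ_p` are the `[E : ℚ]`
embeddings into `ℚ_p` itself. -/
theorem card_ringHom_eq (hcard : Nat.card (E →+* ℚ_[p]) = finrank ℚ E) :
    Nat.card (E →+* M) = finrank ℚ E := by
  rw [← Nat.card_congr (ringHomEquiv E p M hcard), hcard]

/-- The datum's form (row 60): `E/ℚ` Galois with ONE embedding into `ℚ_p` (the degree-one prime of
the datum) — every ring hom `E → M` factors uniquely through `ℚ_p`. -/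
theorem existsUnique_ringHom_factor_of_isGalois [IsGalois ℚ E] (ι₀ : E →+* ℚ_[p]) (ι : E →+* M) :
    ∃! φ : E →+* ℚ_[p], ι = (algebraMap ℚ_[p] M).comp φ :=
  existsUnique_ringHom_factor E p M (T5EmbeddingTorsor.card_ringHom ι₀) ι

/-- The row-59 form: every prime of `E` above `p` has `e · f = 1` (p splits completely) — every
ring hom `E → M` factors uniquely through `ℚ_p`. -/
theorem existsUnique_ringHom_factor_of_degree_one
    (hdeg : ∀ w : IsDedekindDomain.HeightOneSpectrum (NumberField.RingOfIntegers E),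
      w.asIdeal.LiesOver (Ideal.span {(p : ℤ)}) →
        w.asIdeal.ramificationIdx ℤ * w.asIdeal.inertiaDeg ℤ = 1)
    (ι : E →+* M) : ∃! φ : E →+* ℚ_[p], ι = (algebraMap ℚ_[p] M).comp φ :=
  existsUnique_ringHom_factor E p M
    ((T5EmbeddingPrimeEquiv.card_ringHom_eq_ncard_primesOver E p hdeg).trans
      (T5EmbeddingPrimeEquiv.ncard_primesOver_eq_finrank E p hdeg)) ι

end Padic

end Summit.Ventures.HodgeRepro2.T5EmbeddingFactorisation
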